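import Summits.HodgeConjecture.HodgeConjecture.Theorems.Q8SymplecticPowersEndBound
import Summits.HodgeConjecture.HodgeConjecture.Theorems.Q8SymplecticPowersSquare
import Summits.HodgeConjecture.HodgeConjecture.Theorems.Q8SymplecticPowersTranscendentalBirational
import Summits.HodgeConjecture.HodgeConjecture.Theorems.Q8SymplecticPowersUniTranscendental
import Literature.AlgebraicGeometry.Motives.HodgeGroupBlockSummandExtension
import Literature.AlgebraicGeometry.Motives.MumfordTateGroupDirectSum
import HarnessLib

/-!
# Route `Q8SymplecticPowers`, crux K1Q `VeryGeneralQuaternionCommutatorsInHg` (stmt-HodgeConjecture-24190), line `mechanism-v2`,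
# skeleton v5: stub S2 `stub_autFreeReductionQ` (G-AUT-BIR) — PROVED BY NAME

Cell `hodge-nonav`, prover seat `hodge-nonav-prover-Bx` (g20), programme M2 (planner p3 g37 ASSIGN 13:48:22Z, RULING 13:58:29Z).
Sorry-free; axioms standard; no definition; no named fact.

THE STATEMENT (registered, verbatim below). For BIRATIONAL smooth projective complex surfaces `X ~ X'` (Mathlib `Scheme.BirationalOver`) and
pairs `τ, j : X ⟶ X`, `τ', j' : X' ⟶ X'` each satisfying the route's cohomological quaternion relations and eigen-Hodge-number clauses:
`Comm X τ j → Comm X' τ' j'`, where `Uni` = the `ℚ`-automorphisms of `H²` commuting with `τ^*`, `j^*`, preserving `tr(x ∪ y)` and fixing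
`Hdg¹` pointwise, and `Comm` = «every commutator of two `Uni` elements lies in the Hodge group `Hg(H²)`».

THE PROOF («TRANSPORT-T», memo ROUTE-P3v27 §1c, referee g71 SOUND). `T(X) = Hdg¹(H²X)^⊥` is a birational invariant as a rational Hodge
structure with its trace form up to a non-zero scalar: an isomorphism of Hodge structures `Φ : T(X') ⥲ T(X)`,
`tr_X(Φx ∪ Φy) = c · tr_{X'}(x ∪ y)` (`Q8SymplecticPowersTranscendentalBirational`, through a smooth projective roof — Hironaka). Transport
`a' = τ'^*|_{T'}`, `b' = j'^*|_{T'}` to Hodge endomorphisms `a'' = Φ a' Φ⁻¹`, `b''` of `T(X)`; under `Comm X` EVERY Hodge endomorphism of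
`T(X)` is a rational quaternion in `a = τ^*|_T`, `b = j^*|_T` (`Q8SymplecticPowersEndBound.hom_transcendental_eq_quaternion`, the END-BOUND of
K2Q: double commutant + Cayley density), so `D'' = ℚ⟨1, a'', b'', a''b''⟩ ⊆ D = ℚ⟨1, a, b, ab⟩`; `1, a'', b'', a''b''` are independent
(`quaternion_coeffs_eq_zero`, `ℍ_ℚ` is formally real) and `dim D ≤ 4`, so `D'' = D`: an automorphism of `T` commuting with `a'', b''`
commutes with `a, b` — THE PAIRS NEED NOT BE CONJUGATE. Now for `g', h' ∈ Uni(X')`: they preserve `T'`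
(`Q8SymplecticPowersUniTranscendental`); `u = Φ g'|_{T'} Φ⁻¹`, `v` commute with `a, b` and preserve `tr_X ∘ ∪` on `T` (the scalar `c`
cancels), so `1_{Hdg} ⊕ u, 1_{Hdg} ⊕ v ∈ Uni(X)` (`Q8SymplecticPowersBlockExtension.blockExtend_uni`) and `Comm X` puts their commutator
`1 ⊕ [u,v]` in `Hg(H²X)`; RESTRICT to `Hg(T(X))` (`restrictRetract_mem_hodgeGroup`, Moonen's Lemma 4.6), TRANSPORT along `Φ` to
`[g'|_{T'}, h'|_{T'}] ∈ Hg(T(X'))`, and EXTEND by the identity on `Hdg¹(X')`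
(`Polarization.mem_hodgeGroup_of_eq_orthogonal_hodgeClasses`, «`Hg(X × Tate) = Hg(X)`» on `ℚ`-points, brick (TE)): `[g', h'] ∈ Hg(H²X')`.

Honest scope: one stub of a skeleton; K1Q, HC, HC_CM, HC_AV are NOT proved here.

References: D. Huybrechts, *Lectures on K3 Surfaces* (2016), Thm. 3.3.9 (proof), Cor. 3.4; B. Moonen, Yu. Zarhin, Math. Ann. 315 (1999) §3;
R. Hartshorne, *Algebraic Geometry*, II Thm. 8.19, V Remark 5.6.1; R. Goodman, N. Wallach, GTM 255, §4.2.
-/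

set_option linter.dupNamespace false

noncomputable section

open scoped TensorProduct
open CategoryTheory AlgebraicGeometry
open Literature.AlgebraicGeometry Literature.AlgebraicGeometry.Motives Literature.AlgebraicGeometry.HodgeTheory
open Literature.AlgebraicGeometry.HodgeTheory.BettiUniverse
open Literature.AlgebraicGeometry.Motives.HodgeStructure
open Summit.HodgeConjecture.HodgeConjecture.Theorems.Q8SymplecticPowersTranscendentalPart
open Summit.HodgeConjecture.HodgeConjecture.Theorems.Q8SymplecticPowersTranscendentalOrthogonal
open Summit.HodgeConjecture.HodgeConjecture.Theorems.Q8SymplecticPowersBlockExtension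
open Summit.HodgeConjecture.HodgeConjecture.Theorems.Q8SymplecticPowersEndBound
open Summit.HodgeConjecture.HodgeConjecture.Theorems.Q8SymplecticPowersSquare
open Summit.HodgeConjecture.HodgeConjecture.Theorems.Q8SymplecticPowersTranscendentalBirational
open Summit.HodgeConjecture.HodgeConjecture.Theorems.Q8SymplecticPowersUniTranscendental

namespace Summit.HodgeConjecture.HodgeConjecture.Theorems.Q8SymplecticPowersAutFreeReduction

variable {X X' : SchemeOver ℂ}

/-! ### §1 Quaternion algebra bookkeeping on `End_ℚ(T)` -/

/-- **An endomorphism commuting with `a, b` commutes with every element of `ℚ⟨1, a, b, ab⟩`.** [folklore] -/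
theorem comm_of_mem_span {W : Type*} [AddCommGroup W] [Module ℚ W] {a b : Module.End ℚ W} {u : W ≃ₗ[ℚ] W}
    (ha : ∀ x, u (a x) = a (u x)) (hb : ∀ x, u (b x) = b (u x)) {f : Module.End ℚ W}
    (hf : f ∈ Submodule.span ℚ (Set.range ![(1 : Module.End ℚ W), a, b, a * b])) (x : W) : u (f x) = f (u x) := by
  induction hf using Submodule.span_induction generalizing x with
  | mem f hf =>
    obtain ⟨i, rfl⟩ := hf
    fin_cases i
    · rfl
    · exact ha x
    · exact hb x
    · change u (a (b x)) = a (b (u x))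
      rw [ha, hb]
  | zero => simp
  | add f g _ _ hf hg => rw [LinearMap.add_apply, LinearMap.add_apply, map_add, hf, hg]
  | smul c f _ hf => rw [LinearMap.smul_apply, LinearMap.smul_apply, map_smul, hf]

/-- **`1, a, b, ab` are `ℚ`-independent on a non-zero space when `a² = b² = −1`, `ab = −ba`** (`ℍ_ℚ` is a division algebra over the
formally real field `ℚ`; the tree's `quaternion_coeffs_eq_zero`). [cite: GoodmanWallachGTM255, §4.2] -/
theorem linearIndependent_quaternion {W : Type*} [AddCommGroup W] [Module ℚ W] [Nontrivial W] {a b : Module.End ℚ W}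
    (haa : ∀ x, a (a x) = -x) (hbb : ∀ x, b (b x) = -x) (hab : ∀ x, a (b x) = -b (a x)) :
    LinearIndependent ℚ ![(1 : Module.End ℚ W), a, b, a * b] := by
  rw [Fintype.linearIndependent_iff]
  intro c hc
  have h := quaternion_coeffs_eq_zero (⊤ : Submodule ℚ W) top_ne_bot a b (fun _ _ ↦ trivial) (fun _ _ ↦ trivial)
    (fun x _ ↦ haa x) (fun x _ ↦ hbb x) (fun x _ ↦ hab x) (c 0) (c 1) (c 2) (c 3) fun x _ ↦ by
      have hx := LinearMap.congr_fun hc x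
      simpa [Fin.sum_univ_four] using hx
  intro i
  fin_cases i
  · exact h.1
  · exact h.2.1
  · exact h.2.2.1
  · exact h.2.2.2

/-! ### §2 The transfer of `Comm` -/

/-- **`Comm X τ j → Comm X' τ' j'` for birational `X ~ X'`** (the stub, with `Uni`/`Comm` unfolded; see the module docstring for the proof).
[cite: Huybrechts2016K3, Thm. 3.3.9 (proof) and Cor. 3.4] [cite: MoonenZarhin1999LowDim, §3] [cite: Hartshorne1977, II Thm. 8.19 and V Remark 5.6.1] -/
theorem comm_of_birational (hX : IsSmoothProjective 2 X) (hX' : IsSmoothProjective 2 X') (hbir : Scheme.BirationalOver X.hom X'.hom)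
    (τ j : X ⟶ X) (τ' j' : X' ⟶ X') (h4 : pull τ 2 ^ 4 = 1) (hj : pull j 2 ^ 2 = pull τ 2 ^ 2)
    (hrel : pull j 2 * pull τ 2 = pull τ 2 ^ 3 * pull j 2)
    (h20 : Module.finrank ℂ ↥(Module.End.eigenspace ((pull τ 2 ^ 2).baseChange ℂ) 1 ⊓ (hodge exists_isReal_hodgeModel_holds hX 2).piece 2 0) = 0)
    (hpos : 0 < Module.finrank ℂ ↥(Module.End.eigenspace ((pull τ 2 ^ 2).baseChange ℂ) (-1) ⊓ (hodge exists_isReal_hodgeModel_holds hX 2).piece 2 0))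
    (h4' : pull τ' 2 ^ 4 = 1) (hj' : pull j' 2 ^ 2 = pull τ' 2 ^ 2) (hrel' : pull j' 2 * pull τ' 2 = pull τ' 2 ^ 3 * pull j' 2)
    (h20' : Module.finrank ℂ ↥(Module.End.eigenspace ((pull τ' 2 ^ 2).baseChange ℂ) 1 ⊓ (hodge exists_isReal_hodgeModel_holds hX' 2).piece 2 0) = 0)
    (hComm : haveI := finite hX 2; haveI : HodgeTensorFacts.{0, 0} := hodgeTensorFacts_holds;
      ∀ g h : bettiCohomology X 2 ≃ₗ[ℚ] bettiCohomology X 2,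
        ((∀ x, g (pull τ 2 x) = pull τ 2 (g x)) ∧ (∀ x, g (pull j 2 x) = pull j 2 (g x)) ∧
          (∀ x y, tr hX (2 + 2) (cup X 2 2 (g x) (g y)) = tr hX (2 + 2) (cup X 2 2 x y)) ∧
          ∀ x ∈ (hodge exists_isReal_hodgeModel_holds hX 2).hodgeClasses 1, g x = x) →
        ((∀ x, h (pull τ 2 x) = pull τ 2 (h x)) ∧ (∀ x, h (pull j 2 x) = pull j 2 (h x)) ∧
          (∀ x y, tr hX (2 + 2) (cup X 2 2 (h x) (h y)) = tr hX (2 + 2) (cup X 2 2 x y)) ∧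
          ∀ x ∈ (hodge exists_isReal_hodgeModel_holds hX 2).hodgeClasses 1, h x = x) →
        g * h * g⁻¹ * h⁻¹ ∈ (hodge exists_isReal_hodgeModel_holds hX 2).hodgeGroup)
    (g' h' : bettiCohomology X' 2 ≃ₗ[ℚ] bettiCohomology X' 2)
    (hg' : (∀ x, g' (pull τ' 2 x) = pull τ' 2 (g' x)) ∧ (∀ x, g' (pull j' 2 x) = pull j' 2 (g' x)) ∧
      (∀ x y, tr hX' (2 + 2) (cup X' 2 2 (g' x) (g' y)) = tr hX' (2 + 2) (cup X' 2 2 x y)) ∧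
      ∀ x ∈ (hodge exists_isReal_hodgeModel_holds hX' 2).hodgeClasses 1, g' x = x)
    (hh' : (∀ x, h' (pull τ' 2 x) = pull τ' 2 (h' x)) ∧ (∀ x, h' (pull j' 2 x) = pull j' 2 (h' x)) ∧
      (∀ x y, tr hX' (2 + 2) (cup X' 2 2 (h' x) (h' y)) = tr hX' (2 + 2) (cup X' 2 2 x y)) ∧
      ∀ x ∈ (hodge exists_isReal_hodgeModel_holds hX' 2).hodgeClasses 1, h' x = x) :
    haveI := finite hX' 2; haveI : HodgeTensorFacts.{0, 0} := hodgeTensorFacts_holds;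
      g' * h' * g'⁻¹ * h'⁻¹ ∈ (hodge exists_isReal_hodgeModel_holds hX' 2).hodgeGroup := by
  classical
  haveI := finite hX 2
  haveI := finite hX' 2
  haveI : HodgeTensorFacts.{0, 0} := hodgeTensorFacts_holds
  have h11 : (1 : ℤ) + 1 = ((2 : ℕ) : ℤ) := by norm_num
  set H := hodge exists_isReal_hodgeModel_holds hX 2 with hH
  set H' := hodge exists_isReal_hodgeModel_holds hX' 2 with hH'
  obtain ⟨ψ⟩ := hodge_isPolarizable exists_isReal_hodgeModel_holds hX 2
  obtain ⟨ψ'⟩ := hodge_isPolarizable exists_isReal_hodgeModel_holds hX' 2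
  obtain ⟨T, hT⟩ := ψ.exists_subHodgeStructure_eq_orthogonal_hodgeClasses h11
  obtain ⟨T', hT'⟩ := ψ'.exists_subHodgeStructure_eq_orthogonal_hodgeClasses h11
  obtain ⟨S, hS⟩ := ψ.exists_subHodgeStructure_eq_hodgeClasses h11
  obtain ⟨S', hS'⟩ := ψ'.exists_subHodgeStructure_eq_hodgeClasses h11
  have hc : IsCompl (H.hodgeClasses 1) T.toSubmodule := by rw [hT]; exact ψ.isCompl_hodgeClasses_orthogonal h11
  have hcTS : IsCompl T.toSubmodule S.toSubmodule := (ψ.isCompl_of_eq_hodgeClasses_of_eq_orthogonal h11 hS hT).symm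
  have hτT : ∀ x ∈ T.toSubmodule, pull τ 2 x ∈ T.toSubmodule := fun x hx ↦ hT.ge (pull_mem_transcendental hX ψ τ (hT.le hx))
  have hjT : ∀ x ∈ T.toSubmodule, pull j 2 x ∈ T.toSubmodule := fun x hx ↦ hT.ge (pull_mem_transcendental hX ψ j (hT.le hx))
  have hτT' : ∀ x ∈ T'.toSubmodule, pull τ' 2 x ∈ T'.toSubmodule := fun x hx ↦ hT'.ge (pull_mem_transcendental hX' ψ' τ' (hT'.le hx))
  have hjT' : ∀ x ∈ T'.toSubmodule, pull j' 2 x ∈ T'.toSubmodule := fun x hx ↦ hT'.ge (pull_mem_transcendental hX' ψ' j' (hT'.le hx))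
  -- `T ≠ 0`
  have hpg : H.piece 2 0 ≠ ⊥ := by
    intro hbot
    rw [hH] at hbot
    rw [hbot, inf_bot_eq, finrank_bot] at hpos
    exact lt_irrefl _ hpos
  haveI : Nontrivial T.toSubmodule := by
    have hne := transcendental_ne_bot hX ψ hpg
    rw [← hT] at hne
    exact Submodule.nontrivial_iff_ne_bot.2 hne
  -- ### the transport `Φ : T' ⥲ T`
  obtain ⟨Φ, Φ', c, hc0, hΦΦ', hΦ'Φ, hΦQ⟩ := exists_transcendental_transport_of_birationalOver hX hX' hbir ψ ψ' hT hT'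
  let eΦ : T'.toSubmodule ≃ₗ[ℚ] T.toSubmodule :=
    LinearEquiv.ofLinear Φ.toLinearMap Φ'.toLinearMap (LinearMap.ext hΦΦ') (LinearMap.ext hΦ'Φ)
  have heΦ : ∀ x, eΦ x = Φ.toLinearMap x := fun _ ↦ rfl
  have heΦs : ∀ x, eΦ.symm x = Φ'.toLinearMap x := fun _ ↦ rfl
  -- ### the quaternions `a, b` of `X` and the transported quaternions `a'', b''` of `X'`, all acting on `T`
  set a : Module.End ℚ T.toSubmodule := (pull τ 2).restrict hτT with ha
  set b : Module.End ℚ T.toSubmodule := (pull j 2).restrict hjT with hb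
  let aT' : Hom T'.toHodgeStructure T'.toHodgeStructure :=
    ((pullHodgeHom exists_isReal_hodgeModel_holds hodgePQ_independent_of_hodgeModel_holds hX' hX' τ' 2).comp T'.subtypeHom).codRestrict T'
      (fun t ↦ hτT' _ t.2)
  let bT' : Hom T'.toHodgeStructure T'.toHodgeStructure :=
    ((pullHodgeHom exists_isReal_hodgeModel_holds hodgePQ_independent_of_hodgeModel_holds hX' hX' j' 2).comp T'.subtypeHom).codRestrict T'
      (fun t ↦ hjT' _ t.2)
  have haT' : ∀ t : T'.toSubmodule, (aT'.toLinearMap t : bettiCohomology X' 2) = pull τ' 2 t := fun _ ↦ rfl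
  have hbT' : ∀ t : T'.toSubmodule, (bT'.toLinearMap t : bettiCohomology X' 2) = pull j' 2 t := fun _ ↦ rfl
  let A : Hom T.toHodgeStructure T.toHodgeStructure := Φ.comp (aT'.comp Φ')
  let B : Hom T.toHodgeStructure T.toHodgeStructure := Φ.comp (bT'.comp Φ')
  have hA : ∀ x, A.toLinearMap x = Φ.toLinearMap (aT'.toLinearMap (Φ'.toLinearMap x)) := fun _ ↦ rfl
  have hB : ∀ x, B.toLinearMap x = Φ.toLinearMap (bT'.toLinearMap (Φ'.toLinearMap x)) := fun _ ↦ rfl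
  -- relations for `a'', b''` (transported from `X'`)
  obtain ⟨hτ2', hj2', hτj'⟩ := quaternion_relations_on_transcendental hX' ψ' τ' j' h4' hj' hrel' h20'
  have haa' : ∀ t : T'.toSubmodule, aT'.toLinearMap (aT'.toLinearMap t) = -t := fun t ↦ Subtype.ext (by
    rw [haT', haT', Submodule.coe_neg]; exact hτ2' _ (hT'.le t.2))
  have hbb' : ∀ t : T'.toSubmodule, bT'.toLinearMap (bT'.toLinearMap t) = -t := fun t ↦ Subtype.ext (by
    rw [hbT', hbT', Submodule.coe_neg]; exact hj2' _ (hT'.le t.2))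
  have hab' : ∀ t : T'.toSubmodule, aT'.toLinearMap (bT'.toLinearMap t) = -bT'.toLinearMap (aT'.toLinearMap t) := fun t ↦ Subtype.ext (by
    rw [haT', hbT', Submodule.coe_neg, hbT', haT']; exact hτj' _ (hT'.le t.2))
  have hAA : ∀ x, A.toLinearMap (A.toLinearMap x) = -x := fun x ↦ by
    rw [hA, hA, hΦ'Φ, haa', map_neg, hΦΦ']
  have hBB : ∀ x, B.toLinearMap (B.toLinearMap x) = -x := fun x ↦ by
    rw [hB, hB, hΦ'Φ, hbb', map_neg, hΦΦ']
  have hAB : ∀ x, A.toLinearMap (B.toLinearMap x) = -B.toLinearMap (A.toLinearMap x) := fun x ↦ by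
    rw [hA, hB, hA, hB, hΦ'Φ, hΦ'Φ, hab', map_neg]
  -- ### END-BOUND: `A, B, AB ∈ D = ℚ⟨1, a, b, ab⟩`, hence `D'' = ℚ⟨1, A, B, AB⟩ = D`
  set D : Submodule ℚ (Module.End ℚ T.toSubmodule) := Submodule.span ℚ (Set.range ![(1 : Module.End ℚ T.toSubmodule), a, b, a * b]) with hD
  have hmemD : ∀ φ : Hom T.toHodgeStructure T.toHodgeStructure, φ.toLinearMap ∈ D := by
    intro φ
    obtain ⟨α, β, γ, δ, hφ⟩ := hom_transcendental_eq_quaternion hX τ j h4 hj hrel h20 hpos hComm ψ hT hτT hjT φ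
    rw [hφ]
    refine Submodule.add_mem _ (Submodule.add_mem _ (Submodule.add_mem _ ?_ ?_) ?_) ?_
    · exact Submodule.smul_mem _ _ (Submodule.subset_span ⟨0, rfl⟩)
    · exact Submodule.smul_mem _ _ (Submodule.subset_span ⟨1, rfl⟩)
    · exact Submodule.smul_mem _ _ (Submodule.subset_span ⟨2, rfl⟩)
    · exact Submodule.smul_mem _ _ (Submodule.subset_span ⟨3, rfl⟩)
  set D'' : Submodule ℚ (Module.End ℚ T.toSubmodule) :=
    Submodule.span ℚ (Set.range ![(1 : Module.End ℚ T.toSubmodule), A.toLinearMap, B.toLinearMap, A.toLinearMap * B.toLinearMap]) with hD''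
  have hD''le : D'' ≤ D := by
    refine Submodule.span_le.2 ?_
    rintro _ ⟨i, rfl⟩
    fin_cases i
    · exact Submodule.subset_span ⟨0, rfl⟩
    · exact hmemD A
    · exact hmemD B
    · have h := hmemD (A.comp B)
      rw [Hom.comp_toLinearMap] at h
      exact h
  have hD''rank : Module.finrank ℚ D'' = 4 := by
    rw [hD'', finrank_span_eq_card (linearIndependent_quaternion hAA hBB hAB), Fintype.card_fin]
  have hDrank : Module.finrank ℚ D ≤ 4 := by
    have h := finrank_range_le_card (R := ℚ) ![(1 : Module.End ℚ T.toSubmodule), a, b, a * b]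
    rw [Fintype.card_fin] at h
    rw [hD]
    exact h
  have hDD : D'' = D := Submodule.eq_of_le_of_finrank_le hD''le (by rw [hD''rank]; exact hDrank)
  have haD'' : a ∈ D'' := by rw [hDD]; exact Submodule.subset_span ⟨1, rfl⟩
  have hbD'' : b ∈ D'' := by rw [hDD]; exact Submodule.subset_span ⟨2, rfl⟩
  -- ### the restrictions `u', v'` of `g', h'` to `T'` and their transports `u, v` to `T`
  obtain ⟨hg'τ, hg'j, hg'Q, hg'N⟩ := hg'
  obtain ⟨hh'τ, hh'j, hh'Q, hh'N⟩ := hh'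
  obtain ⟨-, -, hg'Qi, hg'Ni⟩ := inv_uni hX' τ' j' ⟨hg'τ, hg'j, hg'Q, hg'N⟩
  obtain ⟨-, -, hh'Qi, hh'Ni⟩ := inv_uni hX' τ' j' ⟨hh'τ, hh'j, hh'Q, hh'N⟩
  have hmapg : T'.toSubmodule.map (g' : bettiCohomology X' 2 →ₗ[ℚ] bettiCohomology X' 2) = T'.toSubmodule := by
    rw [hT']; exact map_transcendental_eq_of_uni hX' ψ' hg'Q hg'N hg'Qi hg'Ni
  have hmaph : T'.toSubmodule.map (h' : bettiCohomology X' 2 →ₗ[ℚ] bettiCohomology X' 2) = T'.toSubmodule := by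
    rw [hT']; exact map_transcendental_eq_of_uni hX' ψ' hh'Q hh'N hh'Qi hh'Ni
  let u' : T'.toSubmodule ≃ₗ[ℚ] T'.toSubmodule := LinearEquiv.ofSubmodules g' _ _ hmapg
  let v' : T'.toSubmodule ≃ₗ[ℚ] T'.toSubmodule := LinearEquiv.ofSubmodules h' _ _ hmaph
  have hu' : ∀ t : T'.toSubmodule, (u' t : bettiCohomology X' 2) = g' t := fun _ ↦ rfl
  have hv' : ∀ t : T'.toSubmodule, (v' t : bettiCohomology X' 2) = h' t := fun _ ↦ rfl
  let u : T.toSubmodule ≃ₗ[ℚ] T.toSubmodule := eΦ.symm ≪≫ₗ u' ≪≫ₗ eΦ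
  let v : T.toSubmodule ≃ₗ[ℚ] T.toSubmodule := eΦ.symm ≪≫ₗ v' ≪≫ₗ eΦ
  have hu : ∀ x, u x = Φ.toLinearMap (u' (Φ'.toLinearMap x)) := fun _ ↦ rfl
  have hv : ∀ x, v x = Φ.toLinearMap (v' (Φ'.toLinearMap x)) := fun _ ↦ rfl
  -- `u, v` commute with `A, B`, hence with `a, b`
  have hu'a : ∀ t, u' (aT'.toLinearMap t) = aT'.toLinearMap (u' t) := fun t ↦ Subtype.ext (by rw [hu', haT', haT', hu', hg'τ])
  have hu'b : ∀ t, u' (bT'.toLinearMap t) = bT'.toLinearMap (u' t) := fun t ↦ Subtype.ext (by rw [hu', hbT', hbT', hu', hg'j])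
  have hv'a : ∀ t, v' (aT'.toLinearMap t) = aT'.toLinearMap (v' t) := fun t ↦ Subtype.ext (by rw [hv', haT', haT', hv', hh'τ])
  have hv'b : ∀ t, v' (bT'.toLinearMap t) = bT'.toLinearMap (v' t) := fun t ↦ Subtype.ext (by rw [hv', hbT', hbT', hv', hh'j])
  have huA : ∀ x, u (A.toLinearMap x) = A.toLinearMap (u x) := fun x ↦ by rw [hu, hu, hA, hA, hΦ'Φ, hΦ'Φ, hu'a]
  have huB : ∀ x, u (B.toLinearMap x) = B.toLinearMap (u x) := fun x ↦ by rw [hu, hu, hB, hB, hΦ'Φ, hΦ'Φ, hu'b]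
  have hvA : ∀ x, v (A.toLinearMap x) = A.toLinearMap (v x) := fun x ↦ by rw [hv, hv, hA, hA, hΦ'Φ, hΦ'Φ, hv'a]
  have hvB : ∀ x, v (B.toLinearMap x) = B.toLinearMap (v x) := fun x ↦ by rw [hv, hv, hB, hB, hΦ'Φ, hΦ'Φ, hv'b]
  have hua : ∀ x, u (a x) = a (u x) := comm_of_mem_span huA huB haD''
  have hub : ∀ x, u (b x) = b (u x) := comm_of_mem_span huA huB hbD''
  have hva : ∀ x, v (a x) = a (v x) := comm_of_mem_span hvA hvB haD''
  have hvb : ∀ x, v (b x) = b (v x) := comm_of_mem_span hvA hvB hbD''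
  -- `u, v` preserve the trace form on `T` (the scalar `c` cancels)
  have hΦ'Q : ∀ x y : T.toSubmodule, c * tr hX' (2 + 2) (cup X' 2 2 (Φ'.toLinearMap x : bettiCohomology X' 2) (Φ'.toLinearMap y)) =
      tr hX (2 + 2) (cup X 2 2 (x : bettiCohomology X 2) y) := fun x y ↦ by
    rw [← hΦQ, hΦΦ', hΦΦ']
  have huQ : ∀ x y : T.toSubmodule, tr hX (2 + 2) (cup X 2 2 (u x : bettiCohomology X 2) (u y)) =
      tr hX (2 + 2) (cup X 2 2 (x : bettiCohomology X 2) y) := fun x y ↦ by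
    rw [hu, hu, hΦQ, hu', hu', hg'Q, hΦ'Q]
  have hvQ : ∀ x y : T.toSubmodule, tr hX (2 + 2) (cup X 2 2 (v x : bettiCohomology X 2) (v y)) =
      tr hX (2 + 2) (cup X 2 2 (x : bettiCohomology X 2) y) := fun x y ↦ by
    rw [hv, hv, hΦQ, hv', hv', hh'Q, hΦ'Q]
  -- in the shape `blockExtend_uni` wants
  have huτ : ∀ x : T.toSubmodule, (u ⟨pull τ 2 x, hT.ge (pull_mem_transcendental hX ψ τ (hT.le x.2))⟩ : bettiCohomology X 2) =
      pull τ 2 (u x : bettiCohomology X 2) := fun x ↦ by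
    have h := congrArg Subtype.val (hua x)
    exact h
  have huj : ∀ x : T.toSubmodule, (u ⟨pull j 2 x, hT.ge (pull_mem_transcendental hX ψ j (hT.le x.2))⟩ : bettiCohomology X 2) =
      pull j 2 (u x : bettiCohomology X 2) := fun x ↦ by
    have h := congrArg Subtype.val (hub x)
    exact h
  have hvτ : ∀ x : T.toSubmodule, (v ⟨pull τ 2 x, hT.ge (pull_mem_transcendental hX ψ τ (hT.le x.2))⟩ : bettiCohomology X 2) =
      pull τ 2 (v x : bettiCohomology X 2) := fun x ↦ by
    have h := congrArg Subtype.val (hva x)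
    exact h
  have hvj : ∀ x : T.toSubmodule, (v ⟨pull j 2 x, hT.ge (pull_mem_transcendental hX ψ j (hT.le x.2))⟩ : bettiCohomology X 2) =
      pull j 2 (v x : bettiCohomology X 2) := fun x ↦ by
    have h := congrArg Subtype.val (hvb x)
    exact h
  -- ### `Comm X`: the commutator of the block extensions lies in `Hg(H²X)`
  have hK : blockExtend hc (u * v * u⁻¹ * v⁻¹) ∈ H.hodgeGroup := by
    rw [blockExtend_commutator]
    exact hComm _ _ (blockExtend_uni hX ψ hT hc τ j u huτ huj huQ) (blockExtend_uni hX ψ hT hc τ j v hvτ hvj hvQ)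
  -- ### RESTRICT to `Hg(T)`
  have hπι : ∀ t : T.toSubmodule, (T.projectionOntoHom S hcTS).toLinearMap (T.subtypeHom.toLinearMap t) = t := fun t ↦ by
    rw [SubHodgeStructure.subtypeHom_toLinearMap, SubHodgeStructure.projectionOntoHom_toLinearMap]
    exact Submodule.projectionOnto_apply_left hcTS t
  have hres := restrictRetract_mem_hodgeGroup T.subtypeHom (T.projectionOntoHom S hcTS) hπι hK
  have hresEq : ∀ w : T.toSubmodule ≃ₗ[ℚ] T.toSubmodule,
      ∀ hw, restrictRetract T.subtypeHom.toLinearMap (T.projectionOntoHom S hcTS).toLinearMap hπι (blockExtend hc w) hw = w := by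
    intro w hw
    refine LinearEquiv.ext fun t ↦ ?_
    rw [restrictRetract_apply, SubHodgeStructure.subtypeHom_toLinearMap, Submodule.subtype_apply, blockExtend_apply_right]
    exact hπι (w t)
  rw [hresEq] at hres
  -- ### TRANSPORT along `Φ` to `Hg(T')`
  have hres' := restrictRetract_mem_hodgeGroup (H₁ := T'.toHodgeStructure) (H := T.toHodgeStructure) Φ Φ' hΦ'Φ hres
  have hresEq' : ∀ hw, restrictRetract Φ.toLinearMap Φ'.toLinearMap hΦ'Φ (u * v * u⁻¹ * v⁻¹) hw = u' * v' * u'⁻¹ * v'⁻¹ := by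
    intro hw
    refine LinearEquiv.ext fun t ↦ ?_
    rw [restrictRetract_apply]
    change Φ'.toLinearMap ((eΦ.symm ≪≫ₗ u' ≪≫ₗ eΦ) ((eΦ.symm ≪≫ₗ v' ≪≫ₗ eΦ)
      ((eΦ.symm ≪≫ₗ u' ≪≫ₗ eΦ)⁻¹ ((eΦ.symm ≪≫ₗ v' ≪≫ₗ eΦ)⁻¹ (Φ.toLinearMap t))))) = u' (v' (u'⁻¹ (v'⁻¹ t)))
    simp only [LinearEquiv.coe_inv, LinearEquiv.trans_symm, LinearEquiv.symm_symm, LinearEquiv.trans_apply, heΦ, heΦs, hΦ'Φ]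
  rw [hresEq'] at hres'
  -- ### EXTEND by the identity on `Hdg¹(X')`
  refine ψ'.mem_hodgeGroup_of_eq_orthogonal_hodgeClasses h11 hS' hT' hres' (fun s hs ↦ ?_) (fun t ↦ ?_)
  · exact commutator_apply_eq_of_forall hg'N hh'N s (hS'.le hs)
  · have hu's : ∀ s : T'.toSubmodule, ((u'⁻¹ s : T'.toSubmodule) : bettiCohomology X' 2) = g'⁻¹ s :=
      fun s ↦ coe_ofSubmodules_symm_apply g' hmapg s
    have hv's : ∀ s : T'.toSubmodule, ((v'⁻¹ s : T'.toSubmodule) : bettiCohomology X' 2) = h'⁻¹ s :=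
      fun s ↦ coe_ofSubmodules_symm_apply h' hmaph s
    change (g' * h' * g'⁻¹ * h'⁻¹) (t : bettiCohomology X' 2) = ((u' * v' * u'⁻¹ * v'⁻¹) t : bettiCohomology X' 2)
    rw [LinearEquiv.mul_apply, LinearEquiv.mul_apply, LinearEquiv.mul_apply, LinearEquiv.mul_apply, LinearEquiv.mul_apply,
      LinearEquiv.mul_apply, hu', hv', hu's, hv's]

/-! ### §3 The stub, by name -/

/-- S2 G-AUT-BIR (M; tree-only Hodge-linear algebra): the leaf's «∀ τ j» reduces to ONE pair on ONE smooth model — for birational smooth projective surfaces `X, X'` and pairs satisfying the binders on each, `Comm X τ j → Comm X' τ' j'` (Lefschetz (1,1) + Hodge index ⇒ `τ*² = −1` on `T`; `ℚ[Q₈]/(z+1) ≅ ℍ_ℚ`; Borel density + double commutant ⇒ `End_Hdg(T) ⊆ B`; birational invariance of `T`). Memo v27 §1c; ref g71 11:16Z SOUND. PROVED: `comm_of_birational` (module docstring). [cite: Huybrechts2016K3, Thm. 3.3.9 (proof) and Cor. 3.4] [cite: MoonenZarhin1999LowDim, §3] [cite: Hartshorne1977, II Thm. 8.19 and V Remark 5.6.1]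 -/
theorem stub_autFreeReductionQ :
    open Literature.AlgebraicGeometry.Motives Literature.AlgebraicGeometry.HodgeTheory Literature.AlgebraicGeometry.HodgeTheory.BettiUniverse CategoryTheory.Limits in let Uni : (X : SchemeOver ℂ) → IsSmoothProjective 2 X → (X ⟶ X) → (X ⟶ X) → (bettiCohomology X 2 ≃ₗ[ℚ] bettiCohomology X 2) → Prop := fun X hX τ j g => (∀ x, g (pull τ 2 x) = pull τ 2 (g x)) ∧ (∀ x, g (pull j 2 x) = pull j 2 (g x)) ∧ (∀ x y, tr hX (2 + 2) (cup X 2 2 (g x) (g y)) = tr hX (2 + 2) (cup X 2 2 x y)) ∧ ∀ x ∈ (hodge exists_isReal_hodgeModel_holds hX 2).hodgeClasses 1, g x = x; let Comm : (X : SchemeOver ℂ) → IsSmoothProjective 2 X → (X ⟶ X) → (X ⟶ X) → Prop := fun X hX τ j => haveI := finite hX 2; haveI : HodgeTensorFacts.{0, 0} := hodgeTensorFacts_holds; ∀ g h : bettiCohomology X 2 ≃ₗ[ℚ] bettiCohomology X 2, Uni X hX τ j g → Uni X hX τ j h → g * h * g⁻¹ * h⁻¹ ∈ (hodge exists_isReal_hodgeModel_holds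 hX 2).hodgeGroup; ∀ ⦃X X' : SchemeOver ℂ⦄ (hX : IsSmoothProjective 2 X) (hX' : IsSmoothProjective 2 X'), AlgebraicGeometry.Scheme.BirationalOver X.hom X'.hom → ∀ (τ j : X ⟶ X) (τ' j' : X' ⟶ X'), (pull τ 2 ^ 4 = 1 ∧ pull j 2 ^ 2 = pull τ 2 ^ 2 ∧ pull j 2 * pull τ 2 = pull τ 2 ^ 3 * pull j 2 ∧ Module.finrank ℂ ↥(Module.End.eigenspace ((pull τ 2 ^ 2).baseChange ℂ) 1 ⊓ (hodge exists_isReal_hodgeModel_holds hX 2).piece 2 0) = 0 ∧ 0 < Module.finrank ℂ ↥(Module.End.eigenspace ((pull τ 2 ^ 2).baseChange ℂ) (-1) ⊓ (hodge exists_isReal_hodgeModel_holds hX 2).piece 2 0)) → (pull τ' 2 ^ 4 = 1 ∧ pull j' 2 ^ 2 = pull τ' 2 ^ 2 ∧ pull j' 2 * pull τ' 2 = pull τ' 2 ^ 3 * pull j' 2 ∧ Module.finrank ℂ ↥(Module.End.eigenspace ((pull τ' 2 ^ 2).baseChange ℂ) 1 ⊓ (hodge exists_isReal_hodgeModel_holds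 hX' 2).piece 2 0) = 0 ∧ 0 < Module.finrank ℂ ↥(Module.End.eigenspace ((pull τ' 2 ^ 2).baseChange ℂ) (-1) ⊓ (hodge exists_isReal_hodgeModel_holds hX' 2).piece 2 0)) → Comm X hX τ j → Comm X' hX' τ' j' := by
  intro Uni Comm X X' hX hX' hbir τ j τ' j' hdeck hdeck' hcomm g' h' hg' hh'
  exact comm_of_birational hX hX' hbir τ j τ' j' hdeck.1 hdeck.2.1 hdeck.2.2.1 hdeck.2.2.2.1 hdeck.2.2.2.2 hdeck'.1 hdeck'.2.1
    hdeck'.2.2.1 hdeck'.2.2.2.1 hcomm g' h' hg' hh'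

end Summit.HodgeConjecture.HodgeConjecture.Theorems.Q8SymplecticPowersAutFreeReduction

end
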